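import Summits.CriticalPhenomena.PercolationContinuityZ3.Theorems.PercNearOneGluingNoHeavyQuantBlockCombLightRoot
import Summits.CriticalPhenomena.PercolationContinuityZ3.Theorems.PercNearOneGluingNoHeavyQuantBlockCombHairRow
import HarnessLib

/-!
# QUANT lane R8, FAR on trees: D-ROOT IN THE CORNER — a block-comb of total mass `≤ 2j` plus ONE LIGHT ROOT BLOB, every floor `x ≥ 1/2`

builds on p205010 (kernel theorem, internal audit signed; external expert review pending)

Support file (`--supports stmt-CriticalPhenomena-4575`), QUANT lane census seat prim-quant-census-1 (gen 14); companion of `…QuantBlockCombLightRoot.lean`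
(D-root for floors with `x³ + x ≥ 1`) and the canonical transport of `IndepBlob.tail_ge_of_oneLight_corner` (`…QuantIndepBlobOneLightCorner.lean`).

* `BlockComb.tail_ge_of_mean_lightRoot_corner` — canonical block-comb (`…QuantBlockCombMergeModel.lean`), floor `x = ∏_{i<D} q i` with `1/2 ≤ x < 1`, every live
  blob other than the root blob `s` has marginal `≥ x`, `lv s = 0`, `x² ≤ g s ≤ x`, `a s ≤ j`, CORNER `Σ_{k ≠ s} a k ≤ 2j`, credit
  `2j < Σ_{k≠s} a k·marg k + a s·(g s − x²)/(1 − x)` ⟹ `x ≤ TAIL`.  Proof: (G) if `g s·Σ_{k≠s} a k ≥ j` the light blob merges (`tail_transfer_le`) and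
  `tail_ge_of_mean` applies to the proper merged block-comb; (F) otherwise split at the gate of `s` (`tail_gate_split`) and apply MARKOV ON THE CLOSED MASS
  (`tail_ge_mean_markov`) to the two block-combs `a[s ↦ a s sure]` and `a[s ↦ 0]`: `1 − TAIL ≤ φ/(n − j)` with `φ = n − B` the closed-mass budget of the other
  blobs, and `φ ≤ (1 − x)(n − j)` by the two-branch algebra of `IndepBlob.tail_ge_of_oneLight_corner` (`κ ≤ 1 − x`: `n − j ≤ j`; `κ > 1 − x`: `g s ≥ 1 − x` and ¬G).
With `tail_ge_of_mean_lightRoot` this gives D-root at every floor `≥ 1/2` whenever the block-comb is in the corner (mass `≤ 2j`); the non-corner at floors in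
`(1/2, 0.6823)` is NOT covered (a block-comb mass row is false on trees, TREES-G14 §2 N2).
[cite: KozmaNitzan2024, Conjecture 3 (p. 15)] (the gluing rows served); the row is [this work].  Theorems only (the `local notation3` of
`…QuantBlockCombMergeModel.lean`, verbatim), no sorries, standard axioms.
-/

namespace Summit.CriticalPhenomena.PercolationContinuityZ3.Theorems

namespace Quant

namespace BlockComb

open Finset

variable {κ : Type*} [Fintype κ] [DecidableEq κ]

/-- product-Bernoulli weight of the set `S` of open blob gates -/
local notation3 "wt[" g ", " S "]" => ∏ k, (if k ∈ (S : Finset κ) then (g : κ → ℝ) k else 1 - (g : κ → ℝ) k)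
/-- probability that the chain `q` of length `D` is open exactly to depth `i` -/
local notation3 "pd[" D ", " q ", " i "]" =>
  (∏ i' ∈ Finset.range (i : ℕ), (q : ℕ → ℝ) i') * (if (i : ℕ) < (D : ℕ) then 1 - (q : ℕ → ℝ) i else 1)
/-- mass counted at depth `i` in blob configuration `S` -/
local notation3 "mass[" lv ", " a ", " i ", " S "]" =>
  ∑ k ∈ (S : Finset κ).filter (fun k => (lv : κ → ℕ) k ≤ (i : ℕ)), ((a : κ → ℕ) k : ℕ)
/-- the tail `P(N ≥ j+1)` of the block-comb count, as an explicit finite sum -/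
local notation3 "TAIL[" D ", " q ", " lv ", " a ", " g ", " j "]" =>
  ∑ i ∈ Finset.range ((D : ℕ) + 1), pd[D, q, i] *
    ∑ S : Finset κ, wt[g, S] * (if (j : ℕ) + 1 ≤ mass[lv, a, i, S] then (1 : ℝ) else 0)

/-- **D-ROOT IN THE CORNER (block-comb of mass `≤ 2j` + one light root blob), every floor `x ≥ 1/2`.**  See the module docstring. [this work] -/
theorem tail_ge_of_mean_lightRoot_corner (D : ℕ) (q : ℕ → ℝ) (hq : ∀ i, 0 ≤ q i ∧ q i ≤ 1) (lv : κ → ℕ) (a : κ → ℕ)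
    (g : κ → ℝ) (hg : ∀ k, 0 ≤ g k ∧ g k ≤ 1) (j : ℕ) (hlv : ∀ k, 0 < a k → lv k ≤ D)
    (x : ℝ) (hxhalf : 1 / 2 ≤ x) (hx1 : x < 1) (hxq : x = ∏ i ∈ Finset.range D, q i)
    (s : κ) (hs0 : lv s = 0) (hgsl : x ^ 2 ≤ g s) (hgsu : g s ≤ x) (hasj : a s ≤ j)
    (hmarg : ∀ k, k ≠ s → 0 < a k → x ≤ (∏ i ∈ Finset.range (lv k), q i) * g k)
    (hcorner : (∑ k ∈ (Finset.univ : Finset κ).erase s, (a k : ℝ)) ≤ 2 * j)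
    (hcredit : (2 * j : ℝ) < (∑ k ∈ (Finset.univ : Finset κ).erase s, (a k : ℝ) * ((∏ i ∈ Finset.range (lv k), q i) * g k)) +
      a s * ((g s - x ^ 2) / (1 - x))) :
    x ≤ TAIL[D, q, lv, a, g, j] := by
  have hx0 : 0 < x := by linarith
  -- aggregate quantities
  set B : ℝ := ∑ k ∈ (Finset.univ : Finset κ).erase s, (a k : ℝ) * ((∏ i ∈ Finset.range (lv k), q i) * g k) with hB
  set C : ℝ := ∑ k ∈ (Finset.univ : Finset κ).erase s, (a k : ℝ) with hC
  have hmargs : (∏ i ∈ Finset.range (lv s), q i) * g s = g s := by rw [hs0]; simp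
  have hEN : ∑ k, (a k : ℝ) * ((∏ i ∈ Finset.range (lv k), q i) * g k) = B + a s * g s := by
    rw [← Finset.add_sum_erase _ _ (Finset.mem_univ s), hmargs, hB]; ring
  have hn : ∑ k, (a k : ℝ) = C + a s := by
    rw [← Finset.add_sum_erase _ _ (Finset.mem_univ s), hC]; ring
  have hC0 : 0 ≤ C := Finset.sum_nonneg fun k _ => Nat.cast_nonneg _
  have hBC : B ≤ C := by
    rw [hB, hC]
    refine Finset.sum_le_sum fun k _ => ?_
    have h1 : (∏ i ∈ Finset.range (lv k), q i) * g k ≤ 1 := by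
      have hp1 : ∏ i ∈ Finset.range (lv k), q i ≤ 1 := Finset.prod_le_one (fun i _ => (hq i).1) fun i _ => (hq i).2
      have hp0 : 0 ≤ ∏ i ∈ Finset.range (lv k), q i := Finset.prod_nonneg fun i _ => (hq i).1
      nlinarith [(hg k).1, (hg k).2]
    have : (0 : ℝ) ≤ a k := Nat.cast_nonneg _
    nlinarith
  have hkappa : (g s - x ^ 2) / (1 - x) ≤ x := by
    rw [div_le_iff₀ (by linarith)]; nlinarith
  have hb0 : (0 : ℝ) ≤ a s := Nat.cast_nonneg _
  have hbj' : ((a s : ℕ) : ℝ) ≤ j := by exact_mod_cast hasj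
  have hg0 : 0 ≤ g s := (hg s).1
  -- total mass exceeds `j`
  have hAj : (j : ℝ) < C + a s := by
    have h1 : (a s : ℝ) * ((g s - x ^ 2) / (1 - x)) ≤ a s * x := mul_le_mul_of_nonneg_left hkappa hb0
    have h2 : (a s : ℝ) * x ≤ a s := by nlinarith
    have hj0 : (0 : ℝ) ≤ j := Nat.cast_nonneg _
    linarith
  by_cases hG : (j : ℝ) ≤ g s * C
  · -- (G) merge the light blob into some live blob, then the proper row `tail_ge_of_mean`
    have hupd : ∀ k, ((Function.update a s 0 k : ℕ) : ℝ) = if k = s then 0 else (a k : ℝ) := by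
      intro k; rw [Function.update_apply]; split_ifs <;> simp
    have hsumupd : ∑ k, ((Function.update a s 0 k : ℕ) : ℝ) = C := by
      rw [Finset.sum_congr rfl fun k _ => hupd k, ← Finset.add_sum_erase _ _ (Finset.mem_univ s), if_pos rfl, zero_add, hC]
      refine Finset.sum_congr rfl fun k hk => ?_
      rw [if_neg (Finset.ne_of_mem_erase hk)]
    have hpos : ∃ k, 0 < Function.update a s 0 k := by
      by_contra hnone
      push Not at hnone
      have hC0' : C = 0 := by
        rw [← hsumupd]; exact Finset.sum_eq_zero fun k _ => by simp [Nat.le_zero.mp (hnone k)]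
      have hgpos : 0 < g s := lt_of_lt_of_le (by positivity) hgsl
      have hj0 : (0 : ℝ) ≤ j := Nat.cast_nonneg _
      have : (j : ℝ) ≤ 0 := by rw [hC0', mul_zero] at hG; exact hG
      have hj00 : (j : ℝ) = 0 := le_antisymm this hj0
      have h1 : (a s : ℝ) * ((g s - x ^ 2) / (1 - x)) ≤ a s * x := mul_le_mul_of_nonneg_left hkappa hb0
      have hB0 : B ≤ 0 := by rw [← hC0']; exact hBC
      nlinarith
    obtain ⟨ℓ, hℓ, hle⟩ := tail_transfer_le D q hq lv a g hg j s hs0 (by rw [hsumupd]; exact hG) hpos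
    have hℓs : ℓ ≠ s := by
      intro h; rw [h, Function.update_self] at hℓ; exact lt_irrefl _ hℓ
    have haℓ : 0 < a ℓ := by rwa [Function.update_of_ne hℓs] at hℓ
    refine le_trans ?_ hle
    -- the merged block-comb: sizes `a' = a[s ↦ 0][ℓ ↦ a ℓ + a s]`
    set a' : κ → ℕ := Function.update (Function.update a s 0) ℓ (Function.update a s 0 ℓ + a s) with ha'
    have ha'app : ∀ k, a' k = if k = ℓ then a ℓ + a s else if k = s then 0 else a k := by
      intro k
      rw [ha', Function.update_apply]
      split_ifs with h1 h2
      · rw [Function.update_of_ne hℓs]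
      · subst h2; rw [Function.update_self]
      · rw [Function.update_of_ne h2]
    have hlv' : ∀ k, 0 < a' k → lv k ≤ D := by
      intro k hk
      rw [ha'app k] at hk
      split_ifs at hk with h1 h2
      · subst h1; exact hlv _ haℓ
      · exact absurd hk (lt_irrefl 0)
      · exact hlv k hk
    have hmarg' : ∀ k, 0 < a' k → x ≤ (∏ i ∈ Finset.range (lv k), q i) * g k := by
      intro k hk
      rw [ha'app k] at hk
      split_ifs at hk with h1 h2
      · subst h1; exact hmarg _ hℓs haℓ
      · exact absurd hk (lt_irrefl 0)
      · exact hmarg k h2 hk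
    have hbudget' : (2 * j : ℝ) < ∑ k, (a' k : ℝ) * ((∏ i ∈ Finset.range (lv k), q i) * g k) := by
      have e : ∑ k, (a' k : ℝ) * ((∏ i ∈ Finset.range (lv k), q i) * g k) =
          B + (a s : ℝ) * ((∏ i ∈ Finset.range (lv ℓ), q i) * g ℓ) := by
        have h' : ∀ k, (a' k : ℝ) * ((∏ i ∈ Finset.range (lv k), q i) * g k) =
            (if k = s then 0 else (a k : ℝ) * ((∏ i ∈ Finset.range (lv k), q i) * g k)) +
              (if k = ℓ then (a s : ℝ) * ((∏ i ∈ Finset.range (lv ℓ), q i) * g ℓ) else 0) := by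
          intro k
          rw [ha'app k]
          by_cases h1 : k = ℓ
          · subst h1; rw [if_pos rfl, if_neg hℓs, if_pos rfl]; push_cast; ring
          · rw [if_neg h1, if_neg h1]
            by_cases h2 : k = s
            · rw [if_pos h2, if_pos h2]; simp
            · rw [if_neg h2, if_neg h2]; simp
        rw [Finset.sum_congr rfl fun k _ => h' k, Finset.sum_add_distrib, Finset.sum_ite_eq' Finset.univ ℓ, if_pos (Finset.mem_univ _),
          ← Finset.add_sum_erase _ _ (Finset.mem_univ s), if_pos rfl, zero_add, hB]
        congr 1
        exact Finset.sum_congr rfl fun k hk => by rw [if_neg (Finset.ne_of_mem_erase hk)]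
      rw [e]
      have h1 : (a s : ℝ) * ((g s - x ^ 2) / (1 - x)) ≤ a s * x := mul_le_mul_of_nonneg_left hkappa hb0
      have h2 : (a s : ℝ) * x ≤ a s * ((∏ i ∈ Finset.range (lv ℓ), q i) * g ℓ) := mul_le_mul_of_nonneg_left (hmarg ℓ hℓs haℓ) hb0
      linarith
    exact tail_ge_of_mean D q hq lv a' g hg j hlv' x hx0 hxq hmarg' hbudget'
  · -- (F) Markov on the closed mass of the other blobs, after splitting at the gate of `s`
    push Not at hG
    have hjC : (j : ℝ) < C := by
      have : (2 * j : ℝ) - j * x < B := by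
        have h1 : (a s : ℝ) * ((g s - x ^ 2) / (1 - x)) ≤ j * x := by
          calc (a s : ℝ) * ((g s - x ^ 2) / (1 - x)) ≤ a s * x := mul_le_mul_of_nonneg_left hkappa hb0
            _ ≤ j * x := mul_le_mul_of_nonneg_right hbj' hx0.le
        linarith
      have hj0 : (0 : ℝ) ≤ j := Nat.cast_nonneg _
      nlinarith
    -- the credit gives `B > 2j − j κ`
    set κs : ℝ := (g s - x ^ 2) / (1 - x) with hκs
    have hκ0 : 0 ≤ κs := div_nonneg (by linarith) (by linarith)
    have hBlow : (2 * j : ℝ) - j * κs < B := by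
      have : (a s : ℝ) * κs ≤ j * κs := mul_le_mul_of_nonneg_right hbj' hκ0
      linarith
    -- `φ = C − B ≤ (1 − x)(C − j)`
    have h1x : 0 < 1 - x := by linarith
    have hj0 : (0 : ℝ) ≤ j := Nat.cast_nonneg _
    have hφ : C - B ≤ (1 - x) * (C - j) := by
      by_cases hk : κs ≤ 1 - x
      · have h1 : (j : ℝ) * κs ≤ j * (1 - x) := mul_le_mul_of_nonneg_left hk hj0
        have h2 : x * C ≤ x * (2 * j) := mul_le_mul_of_nonneg_left hcorner hx0.le
        linarith only [hBlow, h1, h2]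
      · push Not at hk
        have hgpos : 0 < g s := lt_of_lt_of_le (by positivity) hgsl
        have hg1' : 1 - x ≤ g s := by
          have hk' : (1 - x) * (1 - x) < g s - x ^ 2 := by rw [hκs, lt_div_iff₀ h1x] at hk; linarith only [hk]
          nlinarith only [hk', hxhalf]
        have hq' : x ≤ g s * (1 + x - κs) := by
          have e : (g s * (1 + x - κs) - x) * (1 - x) = (x - g s) * (g s + x - 1) := by
            rw [hκs]; field_simp; ring
          have hnn : 0 ≤ (x - g s) * (g s + x - 1) := mul_nonneg (by linarith only [hgsu]) (by linarith only [hg1'])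
          have : 0 ≤ (g s * (1 + x - κs) - x) * (1 - x) := by rw [e]; exact hnn
          have := (mul_nonneg_iff_of_pos_right h1x).mp this
          linarith only [this]
        have h1 : x * (g s * C) < x * j := mul_lt_mul_of_pos_left hG hx0
        have h2 : (j : ℝ) * x ≤ j * (g s * (1 + x - κs)) := mul_le_mul_of_nonneg_left hq' hj0
        have h12 : x * C * g s < (j * (1 + x - κs)) * g s := by linarith only [h1, h2]
        have h3 : x * C < j * (1 + x - κs) := lt_of_mul_lt_mul_right h12 hgpos.le
        linarith only [hBlow, h3]
    -- split at the gate of `s`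
    rw [tail_gate_split D q lv a g j s]
    -- Markov on the closed mass for the two block-combs `a, g[s ↦ 1]` and `a[s ↦ 0], g`
    have hg1_01 : ∀ k, 0 ≤ Function.update g s 1 k ∧ Function.update g s 1 k ≤ 1 := by
      intro k; by_cases hk : k = s
      · rw [hk, Function.update_self]; norm_num
      · rw [Function.update_of_ne hk]; exact hg k
    have hupd0 : ∀ k, ((Function.update a s 0 k : ℕ) : ℝ) = if k = s then 0 else (a k : ℝ) := by
      intro k; rw [Function.update_apply]; split_ifs <;> simp
    have hn0 : ∑ k, ((Function.update a s 0 k : ℕ) : ℝ) = C := by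
      rw [Finset.sum_congr rfl fun k _ => hupd0 k, ← Finset.add_sum_erase _ _ (Finset.mem_univ s), if_pos rfl, zero_add, hC]
      exact Finset.sum_congr rfl fun k hk => by rw [if_neg (Finset.ne_of_mem_erase hk)]
    have hEN0 : ∑ k, ((Function.update a s 0 k : ℕ) : ℝ) * ((∏ i ∈ Finset.range (lv k), q i) * g k) = B := by
      rw [Finset.sum_congr rfl fun k _ => by rw [hupd0 k], ← Finset.add_sum_erase _ _ (Finset.mem_univ s), if_pos rfl, zero_mul, zero_add, hB]
      exact Finset.sum_congr rfl fun k hk => by rw [if_neg (Finset.ne_of_mem_erase hk)]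
    have hEN1 : ∑ k, (a k : ℝ) * ((∏ i ∈ Finset.range (lv k), q i) * Function.update g s 1 k) = B + a s := by
      rw [← Finset.add_sum_erase _ _ (Finset.mem_univ s), Function.update_self, hs0, Finset.prod_range_zero, one_mul, mul_one, hB, add_comm]
      congr 1
      exact Finset.sum_congr rfl fun k hk => by rw [Function.update_of_ne (Finset.ne_of_mem_erase hk)]
    have hlv0 : ∀ k, 0 < Function.update a s 0 k → lv k ≤ D := by
      intro k hk; by_cases hk' : k = s
      · rw [hk', Function.update_self] at hk; exact absurd hk (lt_irrefl 0)
      · rw [Function.update_of_ne hk'] at hk; exact hlv k hk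
    have hmk1 := tail_ge_mean_markov D q hq lv a (Function.update g s 1) hg1_01 j hlv (by rw [hn]; linarith)
    have hmk0 := tail_ge_mean_markov D q hq lv (Function.update a s 0) g hg j hlv0 (by rw [hn0]; exact hjC)
    rw [hEN1, hn] at hmk1
    rw [hEN0, hn0] at hmk0
    -- `1 − T1 ≤ φ/(C − j + a s)` and `1 − T0 ≤ φ/(C − j)`, hence both tails `≥ x`
    have hCj : 0 < C - j := by linarith only [hjC]
    have hT0 : x ≤ TAIL[D, q, lv, Function.update a s 0, g, j] := by
      have h : (B - j) / (C - j) ≥ x := by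
        rw [ge_iff_le, le_div_iff₀ hCj]; linarith only [hφ]
      linarith only [h, hmk0]
    have hT1 : x ≤ TAIL[D, q, lv, a, Function.update g s 1, j] := by
      have hCj' : 0 < C + a s - j := by linarith only [hjC, hb0]
      have h : (B + a s - j) / (C + a s - j) ≥ x := by
        rw [ge_iff_le, le_div_iff₀ hCj']; nlinarith only [hφ, hb0, hx1]
      linarith only [h, hmk1]
    have e1 : g s * x ≤ g s * TAIL[D, q, lv, a, Function.update g s 1, j] := mul_le_mul_of_nonneg_left hT1 hg0
    have e2 : (1 - g s) * x ≤ (1 - g s) * TAIL[D, q, lv, Function.update a s 0, g, j] :=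
      mul_le_mul_of_nonneg_left hT0 (by linarith only [hgsu, hx1])
    linarith only [e1, e2]

end BlockComb

end Quant

end Summit.CriticalPhenomena.PercolationContinuityZ3.Theorems
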